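import Summits.Ventures.MM22.Rank234.RealizeTight
import HarnessLib

/-!
# Cell pub-mm22 — realizability checker, part 4: soundness of the replay check

Cell `pub-mm22` (MatrixMultiplication venture; seat engine-1 g9), topic `Summits/Ventures/MM22`.
HONEST FRAMING: checker PLUMBING with its soundness theorem, not a bound and not a result.  Contents: zero
outputs are impossible at the certified length (`w_ne_zero_of_cert`, dropping a product), the output symmetry
`twistOut` (`(f_i, g_i(· C⁻¹), w_i C)` computes `XY` again), the node lemma `NodeCert.sound`, the tree
induction `RNode.sound`, the assembly helper `RNode.check_S` (lets data files check one representative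
subtree per `decide`), `cert_succ_of_forall_represents` (the profile assembly keeping `β`), and the main theorem `notRealizable_of_check`:
`Cert l m n K N` + `node.check l m n K ph [] = true` ⇒ no computation of `ψ_K` of length `N` is represented
(`Represents`) by a profile that is a permutation of `ph`.  Consumer: `Psi10Phantoms.lean`.  No new facts.
-/

namespace Summit.Ventures.MM22.GF2Cert.Realize

open Summit.MatrixMultiplication.OmegaCensus.GF2RankLB
open Summit.Ventures.MM22.GF2Cert.Profile
open Literature.Computability.AlgebraicComplexity
open Module Matrix

section Comp

variable {l m n : ℕ} {K : List ℕ} {N : ℕ}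

/-- Dropping a product with zero output. -/
def dropZero {φ : ↥(subOf l m K) →ₗ[ZMod 2] Matrix (Fin m) (Fin n) (ZMod 2) →ₗ[ZMod 2]
    Matrix (Fin l) (Fin n) (ZMod 2)} (β : BilinComp φ (Fin N)) (t : Fin N) (ht : β.w t = 0) :
    BilinComp φ {i // i ≠ t} where
  f i := β.f i.1
  g i := β.g i.1
  w i := β.w i.1
  map_eq_sum u v := by
    rw [β.map_eq_sum, ← Finset.sum_erase (Finset.univ) (a := t) (by simp [ht])]
    exact Finset.sum_subtype _ (by simp) (fun i => (β.f i u * β.g i v) • β.w i)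

/-- At the certified length, no output vector vanishes. -/
theorem w_ne_zero_of_cert (hN : Cert l m n K N) (β : BilinComp (psiK l m n K) (Fin N)) (t : Fin N) :
    β.w t ≠ 0 := by
  intro ht
  have hc : Fintype.card {i // i ≠ t} = N - 1 := by
    rw [Fintype.card_subtype_compl, Fintype.card_fin, Fintype.card_unique]
  have := hN _ ((dropZero β t ht).reindex (Fintype.equivFinOfCardEq hc).symm)
  have hpos : 0 < N := Fin.pos t
  omega

/-- Right multiplication by a square matrix, as a linear map. -/
def mulRightL (r c : ℕ) (C : Matrix (Fin c) (Fin c) (ZMod 2)) :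
    Matrix (Fin r) (Fin c) (ZMod 2) →ₗ[ZMod 2] Matrix (Fin r) (Fin c) (ZMod 2) where
  toFun w := w * C
  map_add' a b := Matrix.add_mul a b C
  map_smul' a w := Matrix.smul_mul a w C

/-- **Output symmetry**: twisting the second argument by `C⁻¹` and the outputs by `C`. -/
def twistOut (β : BilinComp (psiK l m n K) (Fin N)) (C Ci : Matrix (Fin n) (Fin n) (ZMod 2))
    (h : Ci * C = 1) : BilinComp (psiK l m n K) (Fin N) :=
  β.comap LinearMap.id (mulRightL m n Ci) (mulRightL l n C) (fun x y => by
    simp only [psiK, LinearMap.comp_apply, Submodule.subtype_apply, mulBilin_apply, LinearMap.id_apply,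
      mulRightL, LinearMap.coe_mk, AddHom.coe_mk]
    rw [Matrix.mul_assoc, Matrix.mul_assoc, h, Matrix.mul_one])

/-- **The node lemma**: at a passing node certificate, the true output value `c` of the (unassigned) product
of class `g` is nonzero, a subset-`xor` of `Z`, and not excluded by membership in any `A_L`. -/
theorem NodeCert.sound {ph : List ℕ} (β : BilinComp (psiK l m n K) (Fin N)) (prof : Fin N → ℕ)
    (hrep : Represents β prof) (hperm : (List.ofFn prof).Perm ph) (hN : Cert l m n K N) {σ : List (ℕ × ℕ)}
    (hσ : ∀ gc ∈ σ, ∀ i, prof i = gc.1 → bitsOfMat (β.w i) = gc.2) (nc : NodeCert) {g : ℕ}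
    (hok : nc.ok l m n K ph σ g = true) {t : Fin N} (ht : prof t = g) (hga : assigned σ g = false) :
    bitsOfMat (β.w t) ∈ allXors nc.Z ∧ bitsOfMat (β.w t) ≠ 0 ∧
      ∀ L ∈ nc.Ls, L.aExcludes l m n σ g (bitsOfMat (β.w t)) = false := by
  simp only [NodeCert.ok, Bool.and_eq_true, List.all_eq_true, decide_eq_true_eq, Bool.not_eq_true',
    bne_iff_ne, ne_eq] at hok
  obtain ⟨⟨⟨⟨⟨⟨⟨hLs, hinv⟩, hlen⟩, hδ⟩, hZlt⟩, hZe⟩, hZk⟩, hdim⟩ := hok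
  subst ht
  have hne : bitsOfMat (β.w t) ≠ 0 := by
    intro h0
    apply w_ne_zero_of_cert hN β t
    rw [← ofBits_bitsOfMat (β.w t), h0]
    ext i j; simp
  have hfacts := fun L (hL : L ∈ nc.Ls) =>
    (LCert.sound β prof hrep hperm hσ L (hLs L hL)).2 t (hinv L hL) hga
  refine ⟨?_, hne, fun L hL => (hfacts L hL).2⟩
  refine mem_allXors_of_dual (nc.rows l m n (prof t)) nc.Esel nc.X nc.Z hlen hδ hZlt hZe hZk hdim
    (bitsOfMat_lt _) fun r hr => ?_
  simp only [NodeCert.rows, List.mem_flatten, List.mem_map] at hr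
  obtain ⟨rs, ⟨L, hLmem, rfl⟩, hr⟩ := hr
  simp only [LCert.rowsFor, List.mem_map] at hr
  obtain ⟨y, hy, rfl⟩ := hr
  rw [← bdot_kronBits]
  exact (hfacts L hLmem).1 y hy

variable {W : ℕ}

/-- **Soundness of the replay check.** -/
theorem RNode.sound {ph : List ℕ} (hW : W = 2 ^ (l * n)) (hN : Cert l m n K N) (prof : Fin N → ℕ)
    (hperm : (List.ofFn prof).Perm ph) :
    ∀ (node : RNode W) (σ : List (ℕ × ℕ)) (β : BilinComp (psiK l m n K) (Fin N)),
      Represents β prof → (∀ gc ∈ σ, ∀ i, prof i = gc.1 → bitsOfMat (β.w i) = gc.2) →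
        node.check l m n K ph σ = true → False := by
  intro node
  induction node with
  | D g nc =>
    intro σ β hrep hσ hc
    simp only [RNode.check, Bool.and_eq_true, decide_eq_true_eq, Bool.not_eq_true', List.all_eq_true,
      Bool.or_eq_true, List.any_eq_true] at hc
    obtain ⟨⟨⟨hg, hga⟩, hok⟩, hall⟩ := hc
    obtain ⟨t, rfl⟩ := exists_index_of_mem hperm hg
    obtain ⟨hmem, hne, hno⟩ := NodeCert.sound β prof hrep hperm hN hσ nc hok rfl hga
    rcases hall _ hmem with h0 | ⟨L, hL, hex⟩
    · exact hne h0
    · rw [hno L hL] at hex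
      exact Bool.false_ne_true hex
  | V L =>
    intro σ β hrep hσ hc
    simp only [RNode.check] at hc
    have hok : L.ok l m n K ph σ = true := by
      simp only [LCert.violated, Bool.and_eq_true] at hc; exact hc.1
    have := (LCert.sound β prof hrep hperm hσ L hok).1
    rw [this] at hc
    exact Bool.false_ne_true hc
  | B g nc kids ih =>
    intro σ β hrep hσ hc
    simp only [RNode.check, Bool.and_eq_true, decide_eq_true_eq, Bool.not_eq_true', List.all_eq_true,
      Bool.or_eq_true, List.any_eq_true] at hc
    obtain ⟨⟨⟨hcnt, hga⟩, hok⟩, hall⟩ := hc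
    have hg : g ∈ ph := List.count_pos_iff.1 (by omega)
    obtain ⟨t, rfl⟩ := exists_index_of_mem hperm hg
    obtain ⟨hmem, hne, hno⟩ := NodeCert.sound β prof hrep hperm hN hσ nc hok rfl hga
    rcases hall _ hmem with (h0 | ⟨L, hL, hex⟩) | hkid
    · exact hne h0
    · rw [hno L hL] at hex
      exact Bool.false_ne_true hex
    · split at hkid
      · next hcW =>
        refine ih _ _ β hrep ?_ hkid
        intro gc hgc i hi
        rcases List.mem_append.1 hgc with hgc | hgc
        · exact hσ gc hgc i hi
        · simp only [List.mem_singleton] at hgc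
          subst hgc
          simp only at hi ⊢
          rw [eq_of_count_eq_one hperm hcnt hi rfl]
      · exact Bool.false_ne_true hkid
  | S g wit reps kids ih =>
    intro σ β hrep hσ hc
    simp only [RNode.check, Bool.and_eq_true, decide_eq_true_eq, List.all_eq_true] at hc
    obtain ⟨⟨⟨_, hcnt⟩, hreps⟩, hall⟩ := hc
    have hg : g ∈ ph := List.count_pos_iff.1 (by omega)
    obtain ⟨t, rfl⟩ := exists_index_of_mem hperm hg
    have hlt : bitsOfMat (β.w t) < W := hW ▸ bitsOfMat_lt _
    rcases hall ⟨_, hlt⟩ with h0 | ⟨hrmem, hCC, hCC'⟩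
    · have := w_ne_zero_of_cert hN β t
      apply this
      rw [← ofBits_bitsOfMat (β.w t), show bitsOfMat (β.w t) = 0 from h0]
      ext i j; simp
    · set c : Fin W := ⟨_, hlt⟩
      set C := ofBits n n (wit c).1
      set Ci := ofBits n n (wit c).2
      have hCiC : Ci * C = 1 := by
        rw [← ofBits_mulBits, hCC', ofBits_oneBits]
      let β' := twistOut β C Ci hCiC
      have hrep' : Represents β' prof := fun i u => by
        simp only [β', twistOut, BilinComp.comap_f]
        exact hrep i u
      have hw' : ∀ i, β'.w i = β.w i * C := fun i => rfl
      have hkid := hreps _ hrmem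
      split at hkid
      · next hrW =>
        have hwt : bitsOfMat (β'.w t) = mulBits l n n (bitsOfMat (β.w t)) (wit c).1 := by
          apply ofBits_inj (bitsOfMat_lt _) (hW ▸ hrW)
          rw [ofBits_bitsOfMat, hw', ofBits_mulBits, ofBits_bitsOfMat]
        refine ih _ _ β' hrep' ?_ hkid
        intro gc hgc i hi
        simp only [List.mem_singleton] at hgc
        subst hgc
        simp only at hi ⊢
        rw [eq_of_count_eq_one hperm hcnt hi rfl, hwt]
      · exact Bool.false_ne_true hkid
  | fail =>
    intro σ β _ _ hc
    simp [RNode.check] at hc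

/-- **Assembling a root symmetry node from separately checked subtrees** (lets data files split the
kernel work: one `decide` per representative subtree, one for the witness table). -/
theorem RNode.check_S {ph : List ℕ} (g : ℕ) (wit : Fin W → ℕ × ℕ) (reps : List ℕ) (kids : Fin W → RNode W)
    (hcnt : ph.count g = 1)
    (hreps : ∀ r ∈ reps, ∃ h : r < W, (kids ⟨r, h⟩).check l m n K ph [(g, r)] = true)
    (hwit : decide (∀ c : Fin W, c.1 = 0 ∨
        (mulBits l n n c.1 (wit c).1 ∈ reps ∧ mulBits n n n (wit c).1 (wit c).2 = oneBits n ∧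
          mulBits n n n (wit c).2 (wit c).1 = oneBits n)) = true) :
    (RNode.S g wit reps kids).check l m n K ph [] = true := by
  simp only [RNode.check, hcnt, hwit, decide_true, Bool.true_and, Bool.and_true, List.all_eq_true]
  intro r hr
  obtain ⟨h, hk⟩ := hreps r hr
  simp [h, hk]

/-- **Assembly keeping the computation** (variant of `cert_succ_of_noValidAllSub`): if every computation of
`ψ_K` has `≥ N` products, `cands` covers the forms on `S_K`, and NO computation of length `N` is represented by a profile
valued in `cands`, then every computation has `≥ N + 1` products. -/
theorem cert_succ_of_forall_represents (hN : Cert l m n K N) (cands : List ℕ) (hcov : coverB l m K cands = true)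
    (hno : ∀ (β : BilinComp (psiK l m n K) (Fin N)) (prof : Fin N → ℕ),
      (∀ i, prof i ∈ cands) → Represents β prof → False) :
    Cert l m n K (N + 1) := by
  classical
  intro r β
  have hNr : N ≤ r := hN r β
  by_contra hlt
  have hrN : r = N := by omega
  subst hrN
  obtain ⟨idx, hidx⟩ := exists_represents hcov β (f_ne_zero_of_cert hN β)
  exact hno β _ (fun i => List.get_mem cands (idx i)) hidx

/-- **Main theorem.** If the replay check of a refutation tree passes at the empty assignment, no
computation of `ψ_K` of the certified length `N` is represented by a permutation of the profile `ph`. -/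
theorem notRealizable_of_check {ph : List ℕ} (hN : Cert l m n K N) (node : RNode (2 ^ (l * n)))
    (hc : node.check l m n K ph [] = true) (β : BilinComp (psiK l m n K) (Fin N)) (prof : Fin N → ℕ)
    (hrep : Represents β prof) (hperm : (List.ofFn prof).Perm ph) : False :=
  RNode.sound rfl hN prof hperm node [] β hrep (fun _ h => by simp at h) hc

end Comp

end Summit.Ventures.MM22.GF2Cert.Realize
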